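import Mathlib
import HarnessLib
import Summits.HubbardSuperconductivity.HubbardSuperconductivity.Theorems.KLProgrammeKLRegimeEngineFrameShiftDressingSupFlowMainAliasGraded
import Summits.HubbardSuperconductivity.HubbardSuperconductivity.Theorems.KLProgrammeKLRegimeEngineLastRespMomentsOfPosition
import Summits.HubbardSuperconductivity.HubbardSuperconductivity.Theorems.KLProgrammeKLRegimeEngineFrameShiftDressingSupFlowMainAliasPos
import Summits.HubbardSuperconductivity.HubbardSuperconductivity.Theorems.KLProgrammeKLRegimeEngineFrameShiftDressingSupFlowMainAliasGradedPure

/-!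
# K3 gen-8-FLOW (stmt 20437, stub (C), located «(B)-MAIN-UNPRIMED», cure «(B)-MAIN-PURE»): THE GENERAL-STEP (B) DOOR AT `Md = 38` WITH ITS KERNEL INPUTS
# IN POSITION SPACE — PURE four-leg moments: `norm_iteratedFDeriv_klLocSelfEnergyRe_flowFrame_sub_le_main_add_alias_pos_pure` (cell gate-hubbard-kl, seat p2 g22)

Twin of p2 g21's `…FrameShiftDressingSupFlowMainAliasPos.…_main_add_alias_pos` (p648976, general-step (B) door of record in position currency) with the
tower input `hNp` — the pinned, spatially weighted `L¹` norm of the FOUR-leg position kernel of the interpolated action `𝒢_t` — asked in the PURE weight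
`(|Δx̃₀|+|Δx̃₁|)ʲ` (displacement between the two external legs; ZERO on the local vertex for `j ≥ 1`) instead of `(1+|Δx̃₀|+|Δx̃₁|)ʲ`; the two-leg rows
`hSp/hSEp`, the envelopes, the regime, `FrameOK` ×2, `fd`, `hZ₂/hZ`, `hq₁/hq₂`, the flow history, the closed envelopes + door, `klEngL₄ ≤ L`, `m ≤ n_β+1`,
`30 ≤ s`, `j ≤ 4` and the CONCLUSION (`MAIN(fd, Np) + alias + far`) are VERBATIM; the proof feeds the pure moments to `…MainAliasGradedPure.…_graded_pure`
through the weight-generic bridge `TwoLegFourier.sum_weight_mul_norm_torusFourierInv_kernel_four_le`.  WHY (KL STATUS 2026-08-28, p2 g22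
«(B)-MAIN-UNPRIMED»): with the pure weight the natural law of `Np` at order `j ≥ 1` is `cN_j·U²·(4^m)ʲ` (bare vertex drops), so `MAIN_j = O(U³)` is bookable
in the (B)-FIT; at `j = 0` nothing changes (`(…)⁰ = 1`).

* **`norm_iteratedFDeriv_klLocSelfEnergyRe_flowFrame_sub_le_main_add_alias_pos_pure`**.

Composition only; no definitions; nothing asserts superconductivity.  References: BGM 2006 §2.1 (2.4)–(2.5), §2.3 (2.17)–(2.24)
[cite: BenfattoGiulianiMastropietro2006]; Salmhofer 1999 §4.2.5.
-/

noncomputable section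

namespace Summit.HubbardSuperconductivity.HubbardSuperconductivity.Theorems.EngineV8

set_option linter.dupNamespace false -- summit = problem name (single-conjunct summit), D-0017

open Real Finset Filter Literature.MathematicalPhysics.QuantumLattice Literature.Probability.LatticeModels GrassmannAlgebra
open Summit.HubbardSuperconductivity.HubbardSuperconductivity.Theorems.KLRegimeSplit
open Summit.HubbardSuperconductivity.HubbardSuperconductivity.Theorems.DispersionFlow
open Summit.HubbardSuperconductivity.HubbardSuperconductivity.Theorems.KLProgrammeLegKernels
open scoped Nat

variable {L M : ℕ} [NeZero L] [NeZero M]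

section MainAliasPos

/-- **THE GENERAL-STEP (B) DOOR AT `Md = 38` WITH ITS KERNEL INPUTS IN POSITION SPACE** — see the module docstring. [cite: BenfattoGiulianiMastropietro2006, §2.3 (2.21)–(2.24)] -/
theorem norm_iteratedFDeriv_klLocSelfEnergyRe_flowFrame_sub_le_main_add_alias_pos_pure {β : ℝ} (hβmin : klBetaMin ≤ β) {U : ℝ} (hU : 0 < U) (hU1 : U ≤ 1) (μ : ℝ) (m : ℕ)
    {G : GeoConsts} {Q : EngConsts} {R : RenConsts} (hRG : ∀ j, 0 ≤ R.Gfr j) (hGS : ∀ k, 0 ≤ G.S k) (hQS : ∀ k, 0 ≤ Q.S' k) (hμ : μ ∈ klWindowC)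
    {Nf₁ Nf₂ : ℕ} (hOK₁ : FrameOK R U Nf₁ μ (klFlowFrameU L M β U μ m)) (hOK₂ : FrameOK R U Nf₂ μ (klFlowFrameU L M β U μ (m + 1)))
    {fd : ℝ} (hfdist : frameDist (klFlowFrameU L M β U μ (m + 1)) (klFlowFrameU L M β U μ m) ≤ fd) (hfd : fd ≤ (klScale klE0 m) / 4)
    (hZ₂ : IsUnit (effPartitionFn ℂ (normalCovariance L M (uvSymbolCT L M β μ (klFlowFrameU L M β U μ (m + 1)) (klScale klE0 m))) (hubbardInteraction L M β U + counterQuadratic L M β (klFlowFrameU L M β U μ (m + 1)))))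
    (hZ : ∀ t ∈ Set.Icc (0 : ℝ) 1, effPartitionFn ℂ
      (normalCovariance L M (uvSymbolCT L M β μ (klFlowFrameU L M β U μ m) (klScale klE0 m)) + ((t : ℂ)) • (normalCovariance L M (fun ks => uvSymbolCT L M β μ (klFlowFrameU L M β U μ (m + 1)) (klScale klE0 m) ks / (1 + uvSymbolCT L M β μ (klFlowFrameU L M β U μ (m + 1)) (klScale klE0 m) ks * (((fsub (klFlowFrameU L M β U μ (m + 1)) (klFlowFrameU L M β U μ m)).eval (latticeMomentum L ks.1.2) / (β * (L : ℝ) ^ 2) : ℝ) : ℂ))) - normalCovariance L M (uvSymbolCT L M β μ (klFlowFrameU L M β U μ m) (klScale klE0 m)))) (hubbardInteraction L M β U + counterQuadratic L M β (klFlowFrameU L M β U μ m)) ≠ 0)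
    (j : ℕ) (q : Momentum) {Np : ℝ} (hNp0 : 0 ≤ Np)
    (hNp : ∀ t ∈ Set.Icc (0 : ℝ) 1, ∀ (σ : Fin 2) (A : HubbardFieldIdx L M) (x₀ : SpaceTimeIdx L M), imagTimeWeight β M ^ 3 *
      ∑ x ∈ (univ : Finset (Fin 4 → SpaceTimeIdx L M)).filter (fun x => x 0 = x₀),
        (((((x 1).2 - (x 0).2) 0).valMinAbs.natAbs : ℝ) + ((((x 1).2 - (x 0).2) 1).valMinAbs.natAbs : ℝ)) ^ j *
          ‖sectorisedKernel L M β (trivialMultiplier L M)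
            (effAction ℂ (normalCovariance L M (uvSymbolCT L M β μ (klFlowFrameU L M β U μ m) (klScale klE0 m)) + ((t : ℂ)) • (normalCovariance L M (fun ks => uvSymbolCT L M β μ (klFlowFrameU L M β U μ (m + 1)) (klScale klE0 m) ks / (1 + uvSymbolCT L M β μ (klFlowFrameU L M β U μ (m + 1)) (klScale klE0 m) ks * (((fsub (klFlowFrameU L M β U μ (m + 1)) (klFlowFrameU L M β U μ m)).eval (latticeMomentum L ks.1.2) / (β * (L : ℝ) ^ 2) : ℝ) : ℂ))) - normalCovariance L M (uvSymbolCT L M β μ (klFlowFrameU L M β U μ m) (klScale klE0 m)))) (hubbardInteraction L M β U + counterQuadratic L M β (klFlowFrameU L M β U μ m))) 4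
            (![((0, σ), 0), ((0, σ), 1), ((0, A.1.2), 1 - A.2), ((0, A.1.2), A.2)] : Fin 4 → SectorLeg 1) x‖ ≤ Np)
    (hq₂ : (Real.pi / β) ^ 2 + frameLevel μ (klFlowFrameU L M β U μ (m + 1)) q ^ 2 < (klScale klE0 m) ^ 2 / 4) (hq₁ : (Real.pi / β) ^ 2 + frameLevel μ (klFlowFrameU L M β U μ m) q ^ 2 < (klScale klE0 m) ^ 2 / 4)
    {s : ℕ} (hs : 30 ≤ s) (hj : j ≤ 4) {Spj Sps SEj SEs Nj Ns Nj' Ns' : ℝ}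
    (hSp : ∀ t ∈ Set.Icc (0 : ℝ) 1, ∀ (σ : Fin 2) (x₀ : SpaceTimeIdx L M),
      (imagTimeWeight β M * ∑ x ∈ (univ : Finset (Fin 2 → SpaceTimeIdx L M)).filter (fun x => x 0 = x₀),
        (1 + ((((x 1).2 - (x 0).2) 0).valMinAbs.natAbs : ℝ) + ((((x 1).2 - (x 0).2) 1).valMinAbs.natAbs : ℝ)) ^ j *
          ‖sectorisedKernel L M β (trivialMultiplier L M)
            (effAction ℂ (normalCovariance L M (uvSymbolCT L M β μ (klFlowFrameU L M β U μ m) (klScale klE0 m)) + ((t : ℂ)) • (normalCovariance L M (fun ks => uvSymbolCT L M β μ (klFlowFrameU L M β U μ (m + 1)) (klScale klE0 m) ks / (1 + uvSymbolCT L M β μ (klFlowFrameU L M β U μ (m + 1)) (klScale klE0 m) ks * (((fsub (klFlowFrameU L M β U μ (m + 1)) (klFlowFrameU L M β U μ m)).eval (latticeMomentum L ks.1.2) / (β * (L : ℝ) ^ 2) : ℝ) : ℂ))) - normalCovariance L M (uvSymbolCT L M β μ (klFlowFrameU L M β U μ m) (klScale klE0 m)))) (hubbardInteraction L M β U + counterQuadratic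 L M β (klFlowFrameU L M β U μ m))) 2
            (![((0, σ), 0), ((0, σ), 1)] : Fin 2 → SectorLeg 1) x‖ ≤ Spj) ∧
      (imagTimeWeight β M * ∑ x ∈ (univ : Finset (Fin 2 → SpaceTimeIdx L M)).filter (fun x => x 0 = x₀),
        (1 + ((((x 1).2 - (x 0).2) 0).valMinAbs.natAbs : ℝ) + ((((x 1).2 - (x 0).2) 1).valMinAbs.natAbs : ℝ)) ^ s *
          ‖sectorisedKernel L M β (trivialMultiplier L M)
            (effAction ℂ (normalCovariance L M (uvSymbolCT L M β μ (klFlowFrameU L M β U μ m) (klScale klE0 m)) + ((t : ℂ)) • (normalCovariance L M (fun ks => uvSymbolCT L M β μ (klFlowFrameU L M β U μ (m + 1)) (klScale klE0 m) ks / (1 + uvSymbolCT L M β μ (klFlowFrameU L M β U μ (m + 1)) (klScale klE0 m) ks * (((fsub (klFlowFrameU L M β U μ (m + 1)) (klFlowFrameU L M β U μ m)).eval (latticeMomentum L ks.1.2) / (β * (L : ℝ) ^ 2) : ℝ) : ℂ))) - normalCovariance L M (uvSymbolCT L M β μ (klFlowFrameU L M β U μ m) (klScale klE0 m)))) (hubbardInteraction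 L M β U + counterQuadratic L M β (klFlowFrameU L M β U μ m))) 2
            (![((0, σ), 0), ((0, σ), 1)] : Fin 2 → SectorLeg 1) x‖ ≤ Sps))
    (hSEp : ∀ (σ : Fin 2) (x₀ : SpaceTimeIdx L M),
      (imagTimeWeight β M * ∑ x ∈ (univ : Finset (Fin 2 → SpaceTimeIdx L M)).filter (fun x => x 0 = x₀),
        (1 + ((((x 1).2 - (x 0).2) 0).valMinAbs.natAbs : ℝ) + ((((x 1).2 - (x 0).2) 1).valMinAbs.natAbs : ℝ)) ^ j *
          ‖sectorisedKernel L M β (trivialMultiplier L M)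
            (effAction ℂ (normalCovariance L M (fun ks => uvSymbolCT L M β μ (klFlowFrameU L M β U μ (m + 1)) (klScale klE0 m) ks / (1 + uvSymbolCT L M β μ (klFlowFrameU L M β U μ (m + 1)) (klScale klE0 m) ks * (((fsub (klFlowFrameU L M β U μ (m + 1)) (klFlowFrameU L M β U μ m)).eval (latticeMomentum L ks.1.2) / (β * (L : ℝ) ^ 2) : ℝ) : ℂ)))) (hubbardInteraction L M β U + counterQuadratic L M β (klFlowFrameU L M β U μ m))) 2
            (![((0, σ), 0), ((0, σ), 1)] : Fin 2 → SectorLeg 1) x‖ ≤ SEj) ∧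
      (imagTimeWeight β M * ∑ x ∈ (univ : Finset (Fin 2 → SpaceTimeIdx L M)).filter (fun x => x 0 = x₀),
        (1 + ((((x 1).2 - (x 0).2) 0).valMinAbs.natAbs : ℝ) + ((((x 1).2 - (x 0).2) 1).valMinAbs.natAbs : ℝ)) ^ s *
          ‖sectorisedKernel L M β (trivialMultiplier L M)
            (effAction ℂ (normalCovariance L M (fun ks => uvSymbolCT L M β μ (klFlowFrameU L M β U μ (m + 1)) (klScale klE0 m) ks / (1 + uvSymbolCT L M β μ (klFlowFrameU L M β U μ (m + 1)) (klScale klE0 m) ks * (((fsub (klFlowFrameU L M β U μ (m + 1)) (klFlowFrameU L M β U μ m)).eval (latticeMomentum L ks.1.2) / (β * (L : ℝ) ^ 2) : ℝ) : ℂ)))) (hubbardInteraction L M β U + counterQuadratic L M β (klFlowFrameU L M β U μ m))) 2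
            (![((0, σ), 0), ((0, σ), 1)] : Fin 2 → SectorLeg 1) x‖ ≤ SEs))
    -- the flow history and the envelope parameters (the cutoff tables are now numerals)
    {n : ℕ} (hP : ∀ m' ≤ n, FlowPieceJetsAt L M β U μ R m') (hTJ : ∀ m' ≤ n, TwoLegReadJetsF L M G Q β U μ m') (hmn : m ≤ n)
    (hR0 : 0 < R.Gfr 0) {W Ξ Θ : ℝ} (hW : W = curveExtC (8 * 576 * (342 : ℝ) ^ 4) G.S 1 + curveExtC (8 * 576 * (342 : ℝ) ^ 4) Q.S' 1 * |U|)
    (hΞ : Ξ = (2 ^ 10 * (1 + Real.pi ^ 8 * (W * U ^ 2) / 2 ^ 11) + ∑ j ∈ range 5, R.Gfr j))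
    (hΘ : Θ = (1 + ((∑ j ∈ range 5, R.Gfr j) + Real.pi ^ 8 * W / 2 ^ 11) * |U| / R.Gfr 0))
    (hdoor : R.Gfr 0 * |U| + ((∑ j ∈ range 5, R.Gfr j) + Real.pi ^ 8 * W / 2 ^ 11) * U ^ 2 ≤ 1 / 128) {P : SplitConsts} (hL : klEngL₄ P R β U ≤ L) (hmβ : m ≤ nScales β + 1)
    (hNj : Spj ≤ Nj) (hNs : Sps ≤ Ns * ((4 : ℝ) ^ m) ^ s) (hNj' : 2 * SEj ≤ Nj') (hNs' : 2 * SEs ≤ Ns' * ((4 : ℝ) ^ m) ^ s) :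
    ‖iteratedFDeriv ℝ j (evalM (symInterp L (fun kv : TorusSite 2 L =>
        klLocSelfEnergyRe L M β U μ (klFlowFrameU L M β U μ (m + 1)) m kv - klLocSelfEnergyRe L M β U μ (klFlowFrameU L M β U μ m) m kv - (fsub (klFlowFrameU L M β U μ (m + 1)) (klFlowFrameU L M β U μ m)).eval (latticeMomentum L kv)))) q‖ ≤
      2 * (2 * (|β| * (L : ℝ) ^ 2) * (12 * (2 * ((klScale klE0 m) * β / Real.pi + 3) * ((1793 * (klScale klE0 m) * (L : ℝ) ^ 2 + 704 * L) + (1793 * (klScale klE0 m) * (L : ℝ) ^ 2 + 704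
        * L)) * (β * (L : ℝ) ^ 2 * (200 + 200 * 4) / (klScale klE0 m) ^ 2 * fd)) * (Np / (β * (L : ℝ) ^ 2) ^ 3))) +
      ((2 ^ 29 * (4 : ℝ) ^ m * Nj ^ 2 + 2 ^ 12 + 2 ^ 23 * Nj') * (Real.sqrt (klEngRsq R) ^ 8 * U ^ 30 / (2 ^ 218 * β ^ 14)) + (2 ^ 26 * (4 : ℝ) ^ m * Ns ^ 2 + 2 ^ 9 + 2 ^ 20 * Ns') * (U
        / (2 ^ 59 * klEngPsq P ^ 2 * klEngRsq R ^ 2 * β ^ 3)) ^ 4) := by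
  have hβ0 : 0 < β := KLRegimeSplit.pos_of_klBetaMin_le hβmin
  have hL0 : (0 : ℝ) < (L : ℝ) := by exact_mod_cast Nat.pos_of_ne_zero (NeZero.ne L)
  have hc0 : 0 < β * (L : ℝ) ^ 2 := by positivity
  -- the tower input `N` from the four-leg position norms (p2 g12 `…kernel_four_le`)
  have hN : ∀ t ∈ Set.Icc (0 : ℝ) 1, ∀ i ∈ ({omega0 M, (omega0 M).rev} : Finset (MatsubaraIdx M)), ∀ σ : Fin 2, ∀ Al : HubbardFieldIdx L M,
      |matsubaraFreq β M Al.1.1.1| < (klScale klE0 m) →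
      (|nambuXiCT L μ (klFlowFrameU L M β U μ m) Al.1.1.2| < (klScale klE0 m) ∨ |nambuXiCT L μ (klFlowFrameU L M β U μ (m + 1)) Al.1.1.2| < (klScale klE0 m)) →
      ∑ x : TorusSite 2 L, (((x 0).valMinAbs.natAbs : ℝ) + ((x 1).valMinAbs.natAbs : ℝ)) ^ j * ‖torusFourierInv (fun kv : TorusSite 2 L =>
        kernel ℂ (effAction ℂ (normalCovariance L M (uvSymbolCT L M β μ (klFlowFrameU L M β U μ m) (klScale klE0 m)) + ((t : ℂ)) • (normalCovariance L M (fun ks => uvSymbolCT L M β μ (klFlowFrameU L M β U μ (m + 1)) (klScale klE0 m) ks / (1 + uvSymbolCT L M β μ (klFlowFrameU L M β U μ (m + 1)) (klScale klE0 m) ks * (((fsub (klFlowFrameU L M β U μ (m + 1)) (klFlowFrameU L M β U μ m)).eval (latticeMomentum L ks.1.2) / (β * (L : ℝ) ^ 2) : ℝ) : ℂ))) - normalCovariance L M (uvSymbolCT L M β μ (klFlowFrameU L M β U μ m) (klScale klE0 m)))) (hubbardInteraction L M β U + counterQuadratic L M β (klFlowFrameU L M β U μ m))) 4 (Fin.snoc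 (Fin.snoc ![((((i, kv), σ), 0) : HubbardFieldIdx L M), (((i, kv), σ), 1)] (Al.1, 1 - Al.2) : Fin 3 → HubbardFieldIdx L M) Al)) x‖ ≤
        Np / (β * (L : ℝ) ^ 2) ^ 3 :=
    fun t ht i _ σ Al _ _ => TwoLegFourier.sum_weight_mul_norm_torusFourierInv_kernel_four_le hβ0 _ i σ Al
      (w := fun y : TorusSite 2 L => (((y 0).valMinAbs.natAbs : ℝ) + ((y 1).valMinAbs.natAbs : ℝ)) ^ j) (fun z => by positivity) (hNp t ht σ Al)
  -- the two-leg rows from position space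
  have hRmom : ∀ t ∈ Set.Icc (0 : ℝ) 1, ∀ i ∈ ({omega0 M, (omega0 M).rev} : Finset (MatsubaraIdx M)), ∀ σ : Fin 2,
      (∑ x : TorusSite 2 L, (1 + ((x 0).valMinAbs.natAbs : ℝ) + ((x 1).valMinAbs.natAbs : ℝ)) ^ j * ‖torusFourierInv (fun kv : TorusSite 2 L =>
        kernel ℂ (effAction ℂ (normalCovariance L M (uvSymbolCT L M β μ (klFlowFrameU L M β U μ m) (klScale klE0 m)) + ((t : ℂ)) • (normalCovariance L M (fun ks => uvSymbolCT L M β μ (klFlowFrameU L M β U μ (m + 1)) (klScale klE0 m) ks / (1 + uvSymbolCT L M β μ (klFlowFrameU L M β U μ (m + 1)) (klScale klE0 m) ks * (((fsub (klFlowFrameU L M β U μ (m + 1)) (klFlowFrameU L M β U μ m)).eval (latticeMomentum L ks.1.2) / (β * (L : ℝ) ^ 2) : ℝ) : ℂ))) - normalCovariance L M (uvSymbolCT L M β μ (klFlowFrameU L M β U μ m) (klScale klE0 m)))) (hubbardInteraction L M β U + counterQuadratic L M β (klFlowFrameU L M β U μ m))) 2 ![((((i, kv), σ), 0) : HubbardFieldIdx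 L M), (((i, kv), σ), 1)]) x‖ ≤ Spj / (β * (L : ℝ) ^ 2)) ∧
      (∑ x : TorusSite 2 L, (1 + ((x 0).valMinAbs.natAbs : ℝ) + ((x 1).valMinAbs.natAbs : ℝ)) ^ s * ‖torusFourierInv (fun kv : TorusSite 2 L =>
        kernel ℂ (effAction ℂ (normalCovariance L M (uvSymbolCT L M β μ (klFlowFrameU L M β U μ m) (klScale klE0 m)) + ((t : ℂ)) • (normalCovariance L M (fun ks => uvSymbolCT L M β μ (klFlowFrameU L M β U μ (m + 1)) (klScale klE0 m) ks / (1 + uvSymbolCT L M β μ (klFlowFrameU L M β U μ (m + 1)) (klScale klE0 m) ks * (((fsub (klFlowFrameU L M β U μ (m + 1)) (klFlowFrameU L M β U μ m)).eval (latticeMomentum L ks.1.2) / (β * (L : ℝ) ^ 2) : ℝ) : ℂ))) - normalCovariance L M (uvSymbolCT L M β μ (klFlowFrameU L M β U μ m) (klScale klE0 m)))) (hubbardInteraction L M β U + counterQuadratic L M β (klFlowFrameU L M β U μ m))) 2 ![((((i, kv), σ), 0) : HubbardFieldIdx L M), (((i, kv), σ), 1)]) x‖ ≤ Sps / (β * (L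 : ℝ) ^ 2)) :=
    fun t ht i _ σ =>
      ⟨TwoLegFourier.sum_weight_mul_norm_torusFourierInv_kernel_two_le hβ0 _ i σ (w := fun y : TorusSite 2 L => (1 + ((y 0).valMinAbs.natAbs : ℝ) + ((y 1).valMinAbs.natAbs : ℝ)) ^ j) (fun z => by positivity)
          (fun x₀ => (hSp t ht σ x₀).1),
        TwoLegFourier.sum_weight_mul_norm_torusFourierInv_kernel_two_le hβ0 _ i σ (w := fun y : TorusSite 2 L => (1 + ((y 0).valMinAbs.natAbs : ℝ) + ((y 1).valMinAbs.natAbs : ℝ)) ^ s) (fun z => by positivity)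
          (fun x₀ => (hSp t ht σ x₀).2)⟩
  have hSE : ∀ i ∈ ({omega0 M, (omega0 M).rev} : Finset (MatsubaraIdx M)), ∀ σ : Fin 2,
      (∑ x : TorusSite 2 L, (1 + ((x 0).valMinAbs.natAbs : ℝ) + ((x 1).valMinAbs.natAbs : ℝ)) ^ j * ‖torusFourierInv (fun kv : TorusSite 2 L =>
        selfEnergy L M β (effAction ℂ (normalCovariance L M (fun ks => uvSymbolCT L M β μ (klFlowFrameU L M β U μ (m + 1)) (klScale klE0 m) ks / (1 + uvSymbolCT L M β μ (klFlowFrameU L M β U μ (m + 1)) (klScale klE0 m) ks * (((fsub (klFlowFrameU L M β U μ (m + 1)) (klFlowFrameU L M β U μ m)).eval (latticeMomentum L ks.1.2) / (β * (L : ℝ) ^ 2) : ℝ) : ℂ)))) (hubbardInteraction L M β U + counterQuadratic L M β (klFlowFrameU L M β U μ m))) (i, kv) σ) x‖ ≤ 2 * SEj) ∧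
      (∑ x : TorusSite 2 L, (1 + ((x 0).valMinAbs.natAbs : ℝ) + ((x 1).valMinAbs.natAbs : ℝ)) ^ s * ‖torusFourierInv (fun kv : TorusSite 2 L =>
        selfEnergy L M β (effAction ℂ (normalCovariance L M (fun ks => uvSymbolCT L M β μ (klFlowFrameU L M β U μ (m + 1)) (klScale klE0 m) ks / (1 + uvSymbolCT L M β μ (klFlowFrameU L M β U μ (m + 1)) (klScale klE0 m) ks * (((fsub (klFlowFrameU L M β U μ (m + 1)) (klFlowFrameU L M β U μ m)).eval (latticeMomentum L ks.1.2) / (β * (L : ℝ) ^ 2) : ℝ) : ℂ)))) (hubbardInteraction L M β U + counterQuadratic L M β (klFlowFrameU L M β U μ m))) (i, kv) σ) x‖ ≤ 2 * SEs) :=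
    fun i _ σ =>
      ⟨TwoLegFourier.sum_momentWeight_norm_torusFourierInv_selfEnergy_le hβ0 _ i σ j (fun x₀ => (hSEp σ x₀).1),
        TwoLegFourier.sum_momentWeight_norm_torusFourierInv_selfEnergy_le hβ0 _ i σ s (fun x₀ => (hSEp σ x₀).2)⟩
  -- the envelopes in the door's currency (`|β|·L²·(Sp/(βL²)) = Sp`)
  have e2 : ∀ X : ℝ, |β| * (L : ℝ) ^ 2 * (X / (β * (L : ℝ) ^ 2)) = X := fun X => by
    rw [abs_of_pos hβ0]; field_simp
  have hNj_d : |β| * (L : ℝ) ^ 2 * (Spj / (β * (L : ℝ) ^ 2)) ≤ Nj := by rw [e2]; exact hNj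
  have hNs_d : |β| * (L : ℝ) ^ 2 * (Sps / (β * (L : ℝ) ^ 2)) ≤ Ns * ((4 : ℝ) ^ m) ^ s := by rw [e2]; exact hNs
  exact norm_iteratedFDeriv_klLocSelfEnergyRe_flowFrame_sub_le_main_add_alias_graded_pure hβmin hU hU1 μ m hRG hGS hQS hμ hOK₁ hOK₂ hfdist hfd hZ₂ hZ j q
    (div_nonneg hNp0 (pow_nonneg hc0.le 3)) hN hq₂ hq₁ hs hj hRmom hSE hP hTJ hmn hR0 hW hΞ hΘ hdoor hL hmβ hNj_d hNs_d hNj' hNs'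

end MainAliasPos

end Summit.HubbardSuperconductivity.HubbardSuperconductivity.Theorems.EngineV8

end
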